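import Mathlib.CategoryTheory.Localization.CalculusOfFractions
import Literature.AlgebraicGeometry.Frobenioids.CoAngularPreSteps
import Literature.AlgebraicGeometry.Frobenioids.BiratLocalizationUniversal
import HarnessLib

/-!
# Frobenioids I, Prop. 4.4 (i): the birationalization is a calculus-of-fractions localization (bridge)

Mochizuki, *The geometry of Frobenioids I*, Kyushu J. Math. **62** (2008), Prop. 4.4 (i) p. 82 and its
proof p. 84 [cite: MochizukiFrdI2008, Prop. 4.4 (i) p.82]. The birationalization `C^birat`
(`Birationalization.lean`, seat abc-iut-L6-t8: `Hom^birat_C(A, B) = colim_{(A' → A) ∈ C^coa-pre_A}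
Hom_C(A', B)`, composition by squares) is, in Mathlib's language, the localization of `C` at the class
`W = coAngularPreSteps F` of co-angular pre-steps computed by RIGHT FRACTIONS. This file supplies the
two facts about `W` on which that rests, for every Frobenioid, and discharges the named hypothesis
`HasBiratSquares F` of `Birationalization.lean`:

* `coAngularPreSteps_hasRightCalculusOfFractions` — `W` has a right calculus of fractions
  (`MorphismProperty.HasRightCalculusOfFractions`): the Ore condition is [FrdI] Prop. 1.11 (vii)
  (`exists_coAngular_square`, seat abc-iut-L1-t1) and the cancellation condition holds because pre-steps
  are monomorphisms (Def. 1.3 (v)(a));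
* `hasBiratSquares_of_isFrobenioid` — Prop. 1.11 (vii) in the shape `HasBiratSquares F` consumed by
  the construction of `C^birat` (RULING C5‴: the hypothesis `hsq` of `Birat F hF hsq` is thereby
  discharged for every Frobenioid).

The universal property (`Functor.IsLocalization (toBirat F hF hsq) (coAngularPreSteps F)`) and the
`PreFrobenioidData.BiratData` instance are the subject of sibling files.
-/

namespace Literature.AlgebraicGeometry.Frobenioids

open CategoryTheory

namespace PreFrobenioid

universe w v v' u u'

variable {D : Type u} [Category.{v} D] {Φ : Dᵒᵖ ⥤ CommMonCat.{w}}
  {C : Type u'} [Category.{v'} C] {F : C ⥤ ElemFrobenioid Φ}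

/-- **[FrdI] Prop. 1.11 (vii) ⇒ the square-completion hypothesis of `C^birat`**: every Frobenioid
satisfies `HasBiratSquares F` (for `φ : X → B` and a co-angular pre-step `β : B' → B` there are a
co-angular pre-step `α' : X' → X` and `φ'' : X' → B'` with `α' ≫ φ = φ'' ≫ β`). This discharges the
hypothesis `hsq` of `Birat F hF hsq`, `toBirat F hF hsq`, … for Frobenioids.
[cite: MochizukiFrdI2008, Prop. 1.11(vii) p.37] -/
theorem hasBiratSquares_of_isFrobenioid (hF : IsFrobenioid F) : HasBiratSquares F :=
  fun _ _ _ φ β hβ => exists_coAngular_square hF β hβ φ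

/-- **[FrdI] Prop. 4.4 (i), calculus of fractions**: in a Frobenioid the class of co-angular pre-steps
has a RIGHT calculus of fractions — Ore condition = Prop. 1.11 (vii), cancellation = pre-steps are
monomorphisms (Def. 1.3 (v)(a)). Hence the morphisms `A → B` of any localization of `C` at `W` are the
right fractions `A ← A' → B` over co-angular pre-steps `A' → A` — the printed
`Hom^birat_C(A, B) = colim_{(A' → A) ∈ C^coa-pre_A} Hom_C(A', B)` — with the printed composition
("independent of the choice of `α', φ''` … since `β` is a monomorphism", p. 84).
[cite: MochizukiFrdI2008, Prop. 4.4 (i) p.82] -/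
theorem coAngularPreSteps_hasRightCalculusOfFractions (hF : IsFrobenioid F) :
    (coAngularPreSteps F).HasRightCalculusOfFractions := by
  haveI := coAngularPreSteps_isMultiplicative hF
  refine { exists_rightFraction := ?_, ext := ?_ }
  · intro X Y φ
    obtain ⟨W, γ, α, hγ, hsq⟩ := exists_coAngular_square hF φ.s φ.hs φ.f
    exact ⟨⟨γ, hγ, α⟩, hsq⟩
  · intro X Y Y' f₁ f₂ s hs h
    haveI := hF.v_a s hs.2
    exact ⟨X, 𝟙 X, MorphismProperty.id_mem _ X, by rw [(cancel_mono s).mp h]⟩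

/-- In particular two arrows of `C` that become equal in ANY functor inverting the co-angular pre-steps and
exhibiting the target as a localization are equalized by a co-angular pre-step; applied to `C^birat`
this is the injectivity of `Hom_C(A', B) → Hom^birat_C(A, B)` up to refinement (p. 82). Stated for
Mathlib's `W.Q`. [cite: MochizukiFrdI2008, Prop. 4.4 (i) p.82] -/
theorem localization_map_eq_iff (hF : IsFrobenioid F) {A B : C} (f₁ f₂ : A ⟶ B) :
    (coAngularPreSteps F).Q.map f₁ = (coAngularPreSteps F).Q.map f₂ ↔
      ∃ (A' : C) (s : A' ⟶ A) (_ : IsCoAngularPreStep F s), s ≫ f₁ = s ≫ f₂ := by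
  haveI := coAngularPreSteps_hasRightCalculusOfFractions hF
  exact MorphismProperty.map_eq_iff_precomp (coAngularPreSteps F).Q (coAngularPreSteps F) f₁ f₂

end PreFrobenioid

end Literature.AlgebraicGeometry.Frobenioids
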